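import Summits.Ventures.PercRepro0.ZhangArms

/-!
# Zhang's argument, chains and connectors: lattice walks from `ReflTransGen` chains (seat p1, gen 2)

Support module for `ZhangSeparation.lean` (P9-separation-p1-v1 Lemma 4.1 in p2's interface
`Zhang.ZhangSeparation`, OFF the declaration path), Mathlib + landed PercRepro0 modules only:

* `exists_walk_of_reflTransGen`: a `ReflTransGen` chain of a one-step relation whose steps are lattice
  steps with a property `P` of the bond is a lattice walk all of whose edges satisfy `P` (the bridge from
  p2's `ReflTransGen` language of `ZhangArms.lean` to the walks of `Potential.lean`);
* `reflTransGen_segment` / `reflTransGen_segment'` / `reflTransGen_swap`: straight chains `f a → ⋯ → f b` and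
  the reversal of a chain of a symmetric relation;
* coordinates: `adj_h` / `adj_v` (the two lattice steps), `mem_box_succ_of_mem_boxPlusBonds` (a bond of
  `E_n^+` has both endpoints in `Λ_{n+1}`), `dualBoundary_cases` (the four sides of `ψ(∂Λ*_N)`);
* the two explicit connectors through the closed box `Λ_n`: `exists_chain_boxPlusBonds` (from `L_n` to `R_n`
  along bonds of `E_n^+` — the «spokes ∪ π» of P9 §4) and `exists_chain_dualBoxBonds` (from `ψ(T*_n)` to
  `ψ(B*_n)` along pairs of `ψ̂(E(Λ*_n))` — the dual connector through the closed box).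

No definitions, no instances, no axioms.
-/

namespace Summit.Ventures.PercRepro0.ZhangChains

open Summit.Ventures.PercRepro0.Defs Summit.Ventures.PercRepro0.Crossing
  Summit.Ventures.PercRepro0.DualMap Summit.Ventures.PercRepro0.Zhang
open scoped Classical

/-! ## Walks from `ReflTransGen` chains, and straight chains -/

/-- A `ReflTransGen` chain of a one-step relation whose steps are lattice steps with a property `P` of the
bond yields a lattice walk all of whose edges satisfy `P`. -/
theorem exists_walk_of_reflTransGen {R : Vertex 2 → Vertex 2 → Prop} {P : Sym2 (Vertex 2) → Prop}
    (hR : ∀ x y, R x y → (lattice 2).Adj x y ∧ P s(x, y)) {u v : Vertex 2}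
    (h : Relation.ReflTransGen R u v) : ∃ w : (lattice 2).Walk u v, ∀ e ∈ w.edges, P e := by
  induction h with
  | refl => exact ⟨SimpleGraph.Walk.nil, fun e he => by simp at he⟩
  | @tail b c _ hbc ih =>
    obtain ⟨w, hw⟩ := ih
    refine ⟨w.concat (hR _ _ hbc).1, fun e he => ?_⟩
    rw [SimpleGraph.Walk.edges_concat, List.concat_eq_append, List.mem_append, List.mem_singleton] at he
    rcases he with he | rfl
    · exact hw e he
    · exact (hR _ _ hbc).2

/-- A straight chain `f a → f (a+1) → ⋯ → f b` (`a ≤ b`). -/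
theorem reflTransGen_segment {R : Vertex 2 → Vertex 2 → Prop} (f : ℤ → Vertex 2) {a b : ℤ} (hab : a ≤ b)
    (hstep : ∀ i, a ≤ i → i < b → R (f i) (f (i + 1))) : Relation.ReflTransGen R (f a) (f b) := by
  obtain ⟨k, rfl⟩ : ∃ k : ℕ, b = a + k := ⟨(b - a).toNat, by omega⟩
  clear hab
  induction k with
  | zero => simp only [Nat.cast_zero, add_zero]; exact Relation.ReflTransGen.refl
  | succ k ih =>
    have h1 : Relation.ReflTransGen R (f a) (f (a + k)) :=
      ih fun i hi hi' => hstep i hi (by push_cast; omega)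
    have h2 : R (f (a + k)) (f (a + k + 1)) := hstep (a + k) (by omega) (by push_cast; omega)
    have h3 : f (a + ((k + 1 : ℕ) : ℤ)) = f (a + k + 1) := by push_cast; ring_nf
    rw [h3]
    exact h1.tail h2

/-- A `ReflTransGen` chain of a symmetric relation can be reversed. -/
theorem reflTransGen_swap {R : Vertex 2 → Vertex 2 → Prop} (hsymm : ∀ x y, R x y → R y x) {u v : Vertex 2}
    (h : Relation.ReflTransGen R u v) : Relation.ReflTransGen R v u := by
  induction h with
  | refl => exact Relation.ReflTransGen.refl
  | tail _ hbc ih => exact Relation.ReflTransGen.head (hsymm _ _ hbc) ih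

/-- A straight chain between `f a` and `f b` in either direction, for a symmetric relation. -/
theorem reflTransGen_segment' {R : Vertex 2 → Vertex 2 → Prop} (hsymm : ∀ x y, R x y → R y x)
    (f : ℤ → Vertex 2) (a b : ℤ) (hstep : ∀ i, min a b ≤ i → i < max a b → R (f i) (f (i + 1))) :
    Relation.ReflTransGen R (f a) (f b) := by
  rcases le_total a b with hab | hab
  · rw [min_eq_left hab, max_eq_right hab] at hstep
    exact reflTransGen_segment f hab hstep
  · rw [min_eq_right hab, max_eq_left hab] at hstep
    exact reflTransGen_swap hsymm (reflTransGen_segment f hab hstep)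

/-- The relation «lattice step along a pair of `S`» is symmetric. -/
theorem symmetric_adj_mem (S : Set (Sym2 (Vertex 2))) (x y : Vertex 2)
    (h : (lattice 2).Adj x y ∧ s(x, y) ∈ S) : (lattice 2).Adj y x ∧ s(y, x) ∈ S :=
  ⟨h.1.symm, by rw [Sym2.eq_swap]; exact h.2⟩

/-- `DOffAdj n ω` is symmetric. -/
theorem symmetric_dOffAdj (n : ℕ) (ω : Config 2) (x y : Vertex 2) (h : DOffAdj n ω x y) : DOffAdj n ω y x := by
  unfold DOffAdj DAdj at h ⊢
  exact ⟨h.1.symm, by rw [Sym2.eq_swap]; exact h.2.1, by rw [Sym2.eq_swap]; exact h.2.2⟩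

/-! ## Coordinates -/

/-- The horizontal lattice step `(i, y) → (i+1, y)`. -/
theorem adj_h (i y : ℤ) : (lattice 2).Adj (pt i y) (pt (i + 1) y) := h_mem_bonds i y

/-- The vertical lattice step `(c, j) → (c, j+1)`. -/
theorem adj_v (c j : ℤ) : (lattice 2).Adj (pt c j) (pt c (j + 1)) := v_mem_bonds c j

/-- Both endpoints of a bond of `E_n^+` lie in `Λ_{n+1}`. -/
theorem mem_box_succ_of_mem_boxPlusBonds {n : ℕ} {e : Sym2 (Vertex 2)} (he : e ∈ boxPlusBonds n)
    {v : Vertex 2} (hv : v ∈ e) : v ∈ box 2 (n + 1) := by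
  induction e using Sym2.ind with
  | h x y =>
    obtain ⟨hb, u, hu, hubox⟩ := he
    rw [mem_bonds_iff] at hb
    rw [Sym2.mem_iff] at hu hv
    rw [mem_box_two] at hubox
    rw [mem_box_two]
    push_cast
    simp only [abs_le] at hubox ⊢
    rcases hb with ⟨h1, h0⟩ | ⟨h0, h1⟩
    · rcases (abs_eq (zero_le_one' ℤ)).1 h0 with h | h <;>
      rcases hu with rfl | rfl <;> rcases hv with rfl | rfl <;> omega
    · rcases (abs_eq (zero_le_one' ℤ)).1 h1 with h | h <;>
      rcases hu with rfl | rfl <;> rcases hv with rfl | rfl <;> omega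

/-- The ends of `ψ(∂Λ*_N)`, in coordinates. -/
theorem dualBoundary_cases {N : ℕ} {y : Vertex 2} (hy : y ∈ dualBoundary N) :
    (-(N : ℤ) ≤ y 0 ∧ y 0 ≤ N + 1 ∧ -((N : ℤ) + 1) ≤ y 1 ∧ y 1 ≤ N) ∧
      (y 0 = N + 1 ∨ y 0 = -(N : ℤ) ∨ y 1 = N ∨ y 1 = -((N : ℤ) + 1)) := by
  have h : dn y = N := hy
  have hle : dn y ≤ N := le_of_eq h
  unfold dn at h hle
  rw [max_le_iff, max_le_iff] at hle
  refine ⟨by omega, ?_⟩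
  rcases max_eq_iff.1 h with ⟨h', -⟩ | ⟨h', -⟩ <;> rcases max_eq_iff.1 h' with ⟨h'', -⟩ | ⟨h'', -⟩ <;> omega

/-! ## The two explicit chains through the closed box -/

/-- **The primal connector through the closed box**: from `vL ∈ L_n` to `vR ∈ R_n` along bonds of `E_n^+`
(the left spoke, the row of `vL` up to the column `n`, that column up or down to the height of `vR`, the right
spoke — the «spokes ∪ π» of P9 §4). -/
theorem exists_chain_boxPlusBonds {n : ℕ} {vL vR : Vertex 2} (hL : vL ∈ leftSide n) (hR : vR ∈ rightSide n) :
    Relation.ReflTransGen (fun x y : Vertex 2 => (lattice 2).Adj x y ∧ s(x, y) ∈ boxPlusBonds n) vL vR := by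
  obtain ⟨hL0, hL1⟩ := hL
  obtain ⟨hR0, hR1⟩ := hR
  rw [abs_le] at hL1 hR1
  have hsymm := symmetric_adj_mem (boxPlusBonds n)
  have e1 : Relation.ReflTransGen (fun x y : Vertex 2 => (lattice 2).Adj x y ∧ s(x, y) ∈ boxPlusBonds n)
      (pt (-((n : ℤ) + 1)) (vL 1)) (pt n (vL 1)) := by
    refine reflTransGen_segment (fun i => pt i (vL 1)) (by omega) fun i hi hi' => ⟨adj_h i (vL 1), ?_⟩
    rw [pair_mem_boxPlusBonds (h_mem_bonds i (vL 1)), mem_box_two, mem_box_two]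
    simp only [pt_zero, pt_one, abs_le]
    right; omega
  have e2 : Relation.ReflTransGen (fun x y : Vertex 2 => (lattice 2).Adj x y ∧ s(x, y) ∈ boxPlusBonds n)
      (pt n (vL 1)) (pt n (vR 1)) := by
    refine reflTransGen_segment' hsymm (fun j => pt n j) (vL 1) (vR 1) fun j hj hj' => ⟨adj_v n j, ?_⟩
    rw [pair_mem_boxPlusBonds (v_mem_bonds n j), mem_box_two, mem_box_two]
    simp only [pt_zero, pt_one, abs_le]
    rw [min_def] at hj
    rw [max_def] at hj'
    left
    split_ifs at hj hj' <;> omega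
  have e3 : Relation.ReflTransGen (fun x y : Vertex 2 => (lattice 2).Adj x y ∧ s(x, y) ∈ boxPlusBonds n)
      (pt n (vR 1)) (pt ((n : ℤ) + 1) (vR 1)) := by
    refine Relation.ReflTransGen.single ⟨adj_h n (vR 1), ?_⟩
    rw [pair_mem_boxPlusBonds (h_mem_bonds n (vR 1)), mem_box_two, mem_box_two]
    simp only [pt_zero, pt_one, abs_le]
    left; omega
  have hvL : vL = pt (-((n : ℤ) + 1)) (vL 1) := eq_pt_of hL0 rfl
  have hvR : vR = pt ((n : ℤ) + 1) (vR 1) := eq_pt_of hR0 rfl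
  rw [hvL, hvR]
  exact (e1.trans e2).trans e3

/-- **The dual connector through the closed box**: from `t ∈ ψ(T*_n)` to `b ∈ ψ(B*_n)` along pairs of
`ψ̂(E(Λ*_n))` (the top row of `ψ(Λ*_n)` to the column of `b`, then straight down). -/
theorem exists_chain_dualBoxBonds {n : ℕ} {t b : Vertex 2} (ht : t ∈ topDual n) (hb : b ∈ botDual n) :
    Relation.ReflTransGen (fun x y : Vertex 2 => (lattice 2).Adj x y ∧ s(x, y) ∈ dualBoxBonds n) t b := by
  obtain ⟨ht0, ht1, ht2⟩ := ht
  obtain ⟨hb0, hb1, hb2⟩ := hb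
  have hsymm := symmetric_adj_mem (dualBoxBonds n)
  have e1 : Relation.ReflTransGen (fun x y : Vertex 2 => (lattice 2).Adj x y ∧ s(x, y) ∈ dualBoxBonds n)
      (pt ((n : ℤ) + 1) (t 1)) (pt ((n : ℤ) + 1) (b 1)) := by
    refine reflTransGen_segment' hsymm (fun j => pt ((n : ℤ) + 1) j) (t 1) (b 1)
      fun j hj hj' => ⟨adj_v _ j, ?_⟩
    rw [pair_mem_dualBoxBonds, mem_dualBox, mem_dualBox]
    simp only [pt_zero, pt_one]
    rw [min_def] at hj
    rw [max_def] at hj'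
    split_ifs at hj hj' <;> omega
  have e2 : Relation.ReflTransGen (fun x y : Vertex 2 => (lattice 2).Adj x y ∧ s(x, y) ∈ dualBoxBonds n)
      (pt ((n : ℤ) + 1) (b 1)) (pt (-(n : ℤ)) (b 1)) := by
    refine reflTransGen_segment' hsymm (fun i => pt i (b 1)) ((n : ℤ) + 1) (-(n : ℤ))
      fun i hi hi' => ⟨adj_h i (b 1), ?_⟩
    rw [pair_mem_dualBoxBonds, mem_dualBox, mem_dualBox]
    simp only [pt_zero, pt_one]
    rw [min_def] at hi
    rw [max_def] at hi'
    split_ifs at hi hi' <;> omega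
  have htt : t = pt ((n : ℤ) + 1) (t 1) := eq_pt_of ht0 rfl
  have hbb : b = pt (-(n : ℤ)) (b 1) := eq_pt_of hb0 rfl
  rw [htt, hbb]
  exact e1.trans e2

end Summit.Ventures.PercRepro0.ZhangChains
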